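import Summits.NavierStokesRegularity.NavierStokesRegularity.Theses.SelfMixingDichotomy
import Summits.NavierStokesRegularity.NavierStokesRegularity.Theorems.SelfMixingDichotomyMixingPayoffReduction
import Summits.NavierStokesRegularity.NavierStokesRegularity.Theorems.SelfMixingDichotomyCoherentScaleExclusionNonMixingExclusion
import HarnessLib

/-!
# Route `SelfMixingDichotomy`: `MixingPayoff ⇔ ∃ δ > 0, no point is cofinally δ-mixing`;
# what this means for the structure cruxes S1, S2 (crux `CoherentScaleExclusion`, stmt-1423)

Support file (`--supports stmt-NavierStokesRegularity-1423`, lead c1 of the line on `CoherentScaleExclusion`; pure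
logic over landed theorems of both lines of the route). Two landed facts are combined:

* `mixingForcesTypeI_of_mixingPayoff` / `mixingPayoff_iff_mixingForcesTypeI` (line `birth` on `MixingPayoff`,
  stmt-1422): P ⇔ H ("cofinal `δ`-mixing forces a Type-I(K) bound", absolute `δ, K`);
* `stub_typeICoherence` (this line): at a Type-I(K) point the drift is NOT `δ'`-mixing at any small scale,
  `0 ≤ δ' ≤ δ₁(K)`.

Together: **`MixingPayoff ⇔ ∃ δ > 0, NoCofinalMixing(δ)`** (`mixingPayoff_iff_exists_noCofinalMixing`), where
NoCofinalMixing(δ) := no final-time point of any standing solution is cofinally `δ`-mixing. The "payoff" crux is a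
pure NON-OCCURRENCE statement: some positive mixing level is never sustained down to `r → 0`, anywhere (at regular
points this is the bounded-drift floor; the content is at singular points).

Consequence for THIS crux (`nonMixingExclusion_at_iff_bdd_of_noCofinalMixing`, `bdd_of_thesis`): at such a level
`δ` EVERY point is recurrently non-`δ`-mixing, so the non-mixing exclusion NME(δ) (⇔ S1 ∧ S2 restricted to `δ`, see
`…CoherentScaleExclusionNonMixingExclusion`) is, at that `δ`, literally "every standing solution is bounded near every
final-time point". The deciding theorem `closes` instantiates S2 and S1 exactly at the `δ` of P. Hence, as the two
lines now stand, instantiating the structure side at the level `δ_P` delivered by P asks it for local regularity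
outright. The balanced reading is on SINGULAR points (last section of this file): S1 ∧ S2 ⇔ "every singular point
is cofinally `δ`-mixing for every `δ > 0`" and P ⇔ "for some `δ > 0` no singular point is cofinally `δ`-mixing" —
complementary bets on blow-up morphology, each allowing blow-up on its own (information for the tenure planner).

Everything is unconditional where no route decl is a hypothesis (standard axioms); no definitions, no named facts.
-/

noncomputable section

-- `Summit = Problem` for this summit; the tree lakefile sets `weak.linter.dupNamespace = false`.
set_option linter.dupNamespace false

namespace Summit.NavierStokesRegularity.NavierStokesRegularity.Theorems

open MeasureTheory Set Metric
open Literature.Analysis.FluidPDE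
open Summit.NavierStokesRegularity.NavierStokesRegularity.Theses.SelfMixingDichotomy

/-- **`MixingPayoff ⇔ ∃ δ > 0`, no final-time point of a standing solution is cofinally `δ`-mixing.** (⇒) P gives H
(`mixingForcesTypeI_of_mixingPayoff`: cofinal `δ_H`-mixing ⇒ Type-I(K)); with `δ₁ = δ₁(K)` from
`stub_typeICoherence` and `δ* = min δ_H δ₁`, a cofinally `δ*`-mixing point would be cofinally `δ_H`-mixing
(`DissipatesAtScale.mono`), hence Type-I(K), hence non-`δ*`-mixing at all small scales — absurd. (⇐) if cofinal
`δ`-mixing never occurs, P holds at `δ` vacuously (through `mixingPayoff_iff_mixingForcesTypeI` with `K = 1`). -/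
theorem mixingPayoff_iff_exists_noCofinalMixing : Summit.NavierStokesRegularity.NavierStokesRegularity.Theses.SelfMixingDichotomy.MixingPayoff ↔ (∃ δ : ℝ, 0 < δ ∧ ∀ T : ℝ, 0 < T → ∀ (u : ℝ → EuclideanSpace ℝ (Fin 3) → EuclideanSpace ℝ (Fin 3)) (p : ℝ → EuclideanSpace ℝ (Fin 3) → ℝ), Literature.Analysis.FluidPDE.IsClassicalNSSolutionOn (Set.Ico 0 T) 1 0 u p → Literature.Analysis.FluidPDE.IsLerayHopfOn T 1 0 (u 0) u → Literature.Analysis.FluidPDE.HasRapidSpatialDecay (u 0) → ∀ x₀ : EuclideanSpace ℝ (Fin 3), ¬ (∃ r₀ : ℝ, 0 < r₀ ∧ ∀ r ∈ Set.Ioo 0 r₀, Literature.Analysis.FluidPDE.DissipatesAtScale u T x₀ r δ)) := by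
  constructor
  · intro hP
    obtain ⟨δ, hδ, K, hK, hH⟩ := mixingForcesTypeI_of_mixingPayoff hP
    obtain ⟨δ₁, hδ₁, hcoh⟩ := stub_typeICoherence K hK
    have hδs : 0 < min δ δ₁ := lt_min hδ hδ₁
    refine ⟨min δ δ₁, hδs, fun T hT u p hcl hLH hdec x₀ hmix => ?_⟩
    obtain ⟨r₀, hr₀, hmix⟩ := hmix
    -- cofinal `δ*`-mixing ⇒ cofinal `δ_H`-mixing ⇒ Type-I(K) ⇒ non-`δ*`-mixing below `r₂`: absurd
    have hTI := hH T u p hT hcl hLH hdec x₀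
      ⟨r₀, hr₀, fun r hr => (hmix r hr).mono hδs.le (min_le_left _ _)⟩
    obtain ⟨r₂, hr₂, hnm⟩ := hcoh T hT u p hcl hLH hdec x₀ hTI
    have h₁ : min r₀ r₂ / 2 < r₀ := by have := min_le_left r₀ r₂; linarith [lt_min hr₀ hr₂]
    have h₂ : min r₀ r₂ / 2 < r₂ := by have := min_le_right r₀ r₂; linarith [lt_min hr₀ hr₂]
    have h₀ : 0 < min r₀ r₂ / 2 := by positivity
    exact hnm (min r₀ r₂ / 2) ⟨h₀, h₂⟩ (min δ δ₁) hδs.le (min_le_right _ _) (hmix (min r₀ r₂ / 2) ⟨h₀, h₁⟩)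
  · rintro ⟨δ, hδ, hno⟩
    exact mixingPayoff_iff_mixingForcesTypeI.2
      ⟨δ, hδ, 1, one_pos, fun T u p hT hcl hLH hdec x₀ hmix => (hno T hT u p hcl hLH hdec x₀ hmix).elim⟩

/-- **At a level `δ` that is never cofinally attained, non-mixing exclusion IS local regularity.** If no final-time
point of any standing solution is cofinally `δ`-mixing (the form of `MixingPayoff` above), then at that `δ` every
point is recurrently non-`δ`-mixing, so "recurrently non-`δ`-mixing points are bounded" (NME(δ), i.e. S1 ∧ S2 at the
level `δ`) holds iff EVERY standing solution is bounded near EVERY final-time point. -/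
theorem nonMixingExclusion_at_iff_bdd_of_noCofinalMixing {δ : ℝ}
    (hno : ∀ T : ℝ, 0 < T → ∀ (u : ℝ → EuclideanSpace ℝ (Fin 3) → EuclideanSpace ℝ (Fin 3))
      (p : ℝ → EuclideanSpace ℝ (Fin 3) → ℝ),
      IsClassicalNSSolutionOn (Set.Ico 0 T) 1 0 u p → IsLerayHopfOn T 1 0 (u 0) u →
      HasRapidSpatialDecay (u 0) → ∀ x₀ : EuclideanSpace ℝ (Fin 3),
      ¬ (∃ r₀ : ℝ, 0 < r₀ ∧ ∀ r ∈ Set.Ioo 0 r₀, DissipatesAtScale u T x₀ r δ)) :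
    (∀ T : ℝ, 0 < T → ∀ (u : ℝ → EuclideanSpace ℝ (Fin 3) → EuclideanSpace ℝ (Fin 3))
      (p : ℝ → EuclideanSpace ℝ (Fin 3) → ℝ),
      IsClassicalNSSolutionOn (Set.Ico 0 T) 1 0 u p → IsLerayHopfOn T 1 0 (u 0) u →
      HasRapidSpatialDecay (u 0) → ∀ x₀ : EuclideanSpace ℝ (Fin 3),
      (∀ r₀ : ℝ, 0 < r₀ → ∃ r ∈ Set.Ioo 0 r₀, ¬ DissipatesAtScale u T x₀ r δ) →
      ∃ ρ : ℝ, 0 < ρ ∧ ∃ M : ℝ, ∀ t ∈ Set.Ioo (T - ρ ^ 2) T, ∀ x ∈ Metric.ball x₀ ρ, ‖u t x‖ ≤ M) ↔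
    (∀ T : ℝ, 0 < T → ∀ (u : ℝ → EuclideanSpace ℝ (Fin 3) → EuclideanSpace ℝ (Fin 3))
      (p : ℝ → EuclideanSpace ℝ (Fin 3) → ℝ),
      IsClassicalNSSolutionOn (Set.Ico 0 T) 1 0 u p → IsLerayHopfOn T 1 0 (u 0) u →
      HasRapidSpatialDecay (u 0) → ∀ x₀ : EuclideanSpace ℝ (Fin 3),
      ∃ ρ : ℝ, 0 < ρ ∧ ∃ M : ℝ, ∀ t ∈ Set.Ioo (T - ρ ^ 2) T, ∀ x ∈ Metric.ball x₀ ρ, ‖u t x‖ ≤ M) := by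
  constructor
  · intro hN T hT u p hcl hLH hdec x₀
    refine hN T hT u p hcl hLH hdec x₀ fun r₀ hr₀ => ?_
    by_contra hall
    push Not at hall
    exact hno T hT u p hcl hLH hdec x₀ ⟨r₀, hr₀, fun r hr => hall r hr⟩
  · exact fun h T hT u p hcl hLH hdec x₀ _ => h T hT u p hcl hLH hdec x₀

/-- **The thesis proves local regularity of standing solutions — and, as the lines stand, asks the structure side for
all of it.** From `Thesis = P ∧ S2 ∧ S1`: P gives a level `δ > 0` never cofinally attained
(`mixingPayoff_iff_exists_noCofinalMixing`), S1 ∧ S2 give NME at that `δ`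
(`sequentialTypeIExclusion_and_coherentScaleExclusion_iff`), and NME at such a `δ` is local regularity
(`nonMixingExclusion_at_iff_bdd_of_noCofinalMixing`). This is the route's deciding argument with the roles made
explicit: every standing Navier–Stokes solution (`ν = 1`) is bounded near every final-time point. -/
theorem bdd_of_thesis (hX : Thesis) :
    ∀ T : ℝ, 0 < T → ∀ (u : ℝ → EuclideanSpace ℝ (Fin 3) → EuclideanSpace ℝ (Fin 3))
      (p : ℝ → EuclideanSpace ℝ (Fin 3) → ℝ),
      IsClassicalNSSolutionOn (Set.Ico 0 T) 1 0 u p → IsLerayHopfOn T 1 0 (u 0) u →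
      HasRapidSpatialDecay (u 0) → ∀ x₀ : EuclideanSpace ℝ (Fin 3),
      ∃ ρ : ℝ, 0 < ρ ∧ ∃ M : ℝ, ∀ t ∈ Set.Ioo (T - ρ ^ 2) T, ∀ x ∈ Metric.ball x₀ ρ, ‖u t x‖ ≤ M := by
  have hX' : MixingPayoff ∧ CoherentScaleExclusion ∧ SequentialTypeIExclusion := hX
  obtain ⟨hP, hS2, hS1⟩ := hX'
  obtain ⟨δ, hδ, hno⟩ := mixingPayoff_iff_exists_noCofinalMixing.1 hP
  have hNME := sequentialTypeIExclusion_and_coherentScaleExclusion_iff.1 ⟨hS1, hS2⟩ δ hδ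
  exact (nonMixingExclusion_at_iff_bdd_of_noCofinalMixing hno).1 hNME

/-! ### The split of the route, stated on singular points only

The two load-free halves, restricted to final-time points near which `u` is UNBOUNDED (the only points where either
has content), are exact complements — this is the balanced reading of the route (the module docstring's "collapse"
describes only what happens if one insists on instantiating the structure side at the level `δ_P` first):

* structure side `S1 ∧ S2` ⇔ every such point is cofinally `δ`-mixing for EVERY `δ > 0` ("singular points are
  infinitely mixing": `sequentialTypeIExclusion_and_coherentScaleExclusion_iff_singular_infinitelyMixing`);
* payoff side `MixingPayoff` ⇔ for SOME `δ > 0` no such point is cofinally `δ`-mixing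
  (`mixingPayoff_iff_singular_not_cofinallyMixing`).

Each half alone allows blow-up (infinitely-mixing blow-up, resp. any blow-up that fails to mix at some fixed level);
together they allow none. Which half is harder is a bet on blow-up morphology, not a matter of logic. -/

/-- **Structure side on singular points: `S1 ∧ S2 ⇔` every final-time point of a standing solution near which `u`
is unbounded is cofinally `δ`-mixing for every `δ > 0`.** (Contraposition of the non-mixing exclusion form
`sequentialTypeIExclusion_and_coherentScaleExclusion_iff`.) So the structure cruxes of the route say exactly:
a singularity of a finite-energy classical solution must stir EVERY scale-`r` blob below ANY prescribed `L²` fraction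
within half a diffusive time, at all sufficiently small scales `r` — "singular points are infinitely mixing". -/
theorem sequentialTypeIExclusion_and_coherentScaleExclusion_iff_singular_infinitelyMixing : (Summit.NavierStokesRegularity.NavierStokesRegularity.Theses.SelfMixingDichotomy.SequentialTypeIExclusion ∧ Summit.NavierStokesRegularity.NavierStokesRegularity.Theses.SelfMixingDichotomy.CoherentScaleExclusion) ↔ (∀ T : ℝ, 0 < T → ∀ (u : ℝ → EuclideanSpace ℝ (Fin 3) → EuclideanSpace ℝ (Fin 3)) (p : ℝ → EuclideanSpace ℝ (Fin 3) → ℝ), Literature.Analysis.FluidPDE.IsClassicalNSSolutionOn (Set.Ico 0 T) 1 0 u p → Literature.Analysis.FluidPDE.IsLerayHopfOn T 1 0 (u 0) u → Literature.Analysis.FluidPDE.HasRapidSpatialDecay (u 0) → ∀ x₀ : EuclideanSpace ℝ (Fin 3), ¬ (∃ ρ : ℝ, 0 < ρ ∧ ∃ M : ℝ, ∀ t ∈ Set.Ioo (T - ρ ^ 2) T, ∀ x ∈ Metric.ball x₀ ρ, ‖u t x‖ ≤ M) → ∀ δ : ℝ, 0 < δ → ∃ r₀ : ℝ, 0 < r₀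 ∧ ∀ r ∈ Set.Ioo 0 r₀, Literature.Analysis.FluidPDE.DissipatesAtScale u T x₀ r δ) := by
  rw [sequentialTypeIExclusion_and_coherentScaleExclusion_iff]
  constructor
  · intro hN T hT u p hcl hLH hdec x₀ hnb δ hδ
    by_contra hno
    push Not at hno
    exact hnb (hN δ hδ T hT u p hcl hLH hdec x₀ fun r₀ hr₀ => hno r₀ hr₀)
  · intro hI δ hδ T hT u p hcl hLH hdec x₀ hrec
    by_contra hnb
    obtain ⟨r₀, hr₀, hmix⟩ := hI T hT u p hcl hLH hdec x₀ hnb δ hδ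
    obtain ⟨r, hr, hnm⟩ := hrec r₀ hr₀
    exact hnm (hmix r hr)

/-- **Payoff side on singular points: `MixingPayoff ⇔` for some `δ > 0`, no final-time point of a standing solution
near which `u` is unbounded is cofinally `δ`-mixing.** (⇒) from `mixingPayoff_iff_exists_noCofinalMixing` (no point
at all is). (⇐) if singular points are never cofinally `δ`-mixing, a cofinally `δ`-mixing point is a point of local
boundedness, which is `MixingPayoff` at `δ` (through `mixingPayoff_iff_mixingForcesTypeI`, `K = 1`: bounded points
are Type-I(1) on a small cylinder). Together with the previous theorem: the route's two halves are complementary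
statements about singular points — infinitely mixing (structure side) versus not cofinally `δ`-mixing at one fixed
level (payoff side). -/
theorem mixingPayoff_iff_singular_not_cofinallyMixing : Summit.NavierStokesRegularity.NavierStokesRegularity.Theses.SelfMixingDichotomy.MixingPayoff ↔ (∃ δ : ℝ, 0 < δ ∧ ∀ T : ℝ, 0 < T → ∀ (u : ℝ → EuclideanSpace ℝ (Fin 3) → EuclideanSpace ℝ (Fin 3)) (p : ℝ → EuclideanSpace ℝ (Fin 3) → ℝ), Literature.Analysis.FluidPDE.IsClassicalNSSolutionOn (Set.Ico 0 T) 1 0 u p → Literature.Analysis.FluidPDE.IsLerayHopfOn T 1 0 (u 0) u → Literature.Analysis.FluidPDE.HasRapidSpatialDecay (u 0) → ∀ x₀ : EuclideanSpace ℝ (Fin 3), ¬ (∃ ρ : ℝ, 0 < ρ ∧ ∃ M : ℝ, ∀ t ∈ Set.Ioo (T - ρ ^ 2) T, ∀ x ∈ Metric.ball x₀ ρ, ‖u t x‖ ≤ M) → ¬ (∃ r₀ : ℝ, 0 < r₀ ∧ ∀ r ∈ Set.Ioo 0 r₀, Literature.Analysis.FluidPDE.DissipatesAtScale u T x₀ r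 δ)) := by
  constructor
  · intro hP
    obtain ⟨δ, hδ, hno⟩ := mixingPayoff_iff_exists_noCofinalMixing.1 hP
    exact ⟨δ, hδ, fun T hT u p hcl hLH hdec x₀ _ => hno T hT u p hcl hLH hdec x₀⟩
  · rintro ⟨δ, hδ, hno⟩
    -- `MixingPayoff` at `δ`: a cofinally `δ`-mixing point is bounded (else `hno` is contradicted).
    have hPδ : ∀ T : ℝ, 0 < T → ∀ (u : ℝ → EuclideanSpace ℝ (Fin 3) → EuclideanSpace ℝ (Fin 3))
        (p : ℝ → EuclideanSpace ℝ (Fin 3) → ℝ),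
        IsClassicalNSSolutionOn (Set.Ico 0 T) 1 0 u p → IsLerayHopfOn T 1 0 (u 0) u →
        HasRapidSpatialDecay (u 0) → ∀ x₀ : EuclideanSpace ℝ (Fin 3),
        (∃ r₀ : ℝ, 0 < r₀ ∧ ∀ r ∈ Set.Ioo 0 r₀, DissipatesAtScale u T x₀ r δ) →
        ∃ ρ : ℝ, 0 < ρ ∧ ∃ M : ℝ, ∀ t ∈ Set.Ioo (T - ρ ^ 2) T, ∀ x ∈ Metric.ball x₀ ρ, ‖u t x‖ ≤ M := by
      intro T hT u p hcl hLH hdec x₀ hmix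
      by_contra hnb
      exact hno T hT u p hcl hLH hdec x₀ hnb hmix
    exact ⟨δ, hδ, hPδ⟩

end Summit.NavierStokesRegularity.NavierStokesRegularity.Theorems

end
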